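import Summits.PneNP.PneNP.Theorems.ChebyshevTracialDesignBulkScale
import HarnessLib

/-!
# Cell pnp-psdrank, route `ChebyshevTracialDesign`: brick 120's seven remainders against a CONSTANT smoothness bound —
# brick 126a (crux `TracialDecayExp20`, stmt-PneNP-19878)

Brick 126a (prover g25). Bricks 120/122/123/124/125 bound the tilted crossing-plane (CG_1′) value per matching by an explicit
sum of seven pure remainders, linear in the three smoothness numbers `ρ^{D+1}X_{D+1}`, `ρ^D X_D`, `ρ^{D−1}X_{D−1}` with
coefficients built from `B_v·C((T−1)/2, D+1)`, `(2D+1)·C(2D,D)/4^D`, `9t²G`, `3tG`, `G`, `T`, `2(D+1)`, `2D`, `|H|/n`,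
`|H|²/(n(n−2))`. This file collapses that expression once the three smoothness numbers are replaced by `r_i·Ξ` with
`r_i ≤ 1`:

* **`remainder_le`** — with `r₁, r₂, r₃ ≤ 1`, `h = |H|/n ≤ 1`, `h₂ = |H|²/(n(n−2)) ≤ 1`, `cD = C(2D,D)/4^D ≤ 1`, `T ≤ t`
  and `2D + 2 ≤ t`, the remainder expression (copied verbatim from brick 124's statement, atoms generalised to reals)
  is `≤ 200·t²·G·((2D+1) + B_v C_b)·Ξ`. Proof: `gcongr` to the majorant with `r_i, h, h₂, cD ↦ 1`, `T ↦ t`, which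
  `ring` identifies as `Ξ·G·((2D+1)(4+18D+27t) + B_v C_b(8+44D+36D²+76t+36t²+72Dt))`, then `D ≤ t/2 − 1`, `1 ≤ t`.
READING: bookkeeping only (brick 126 instantiates it). WHAT THIS FILE DOES NOT DO: anything combinatorial; anything on
`TracialDecayExp20` itself, psd rank of P_PM(K_n), or P vs NP. [cite: Rothvoss2017, §2 (PDF p. 6)]
[cite: Agarwal2000DifferenceEquations, Remark 1.8.1 (1.8.8)]
Stature: support/instrument (kernel lane, no defs, axioms standard). Supports stmt-PneNP-19878.
-/

set_option linter.dupNamespace false -- `Summit.PneNP.PneNP.…`: summit = sub-problem (D-0017)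

noncomputable section

namespace Summit.PneNP.PneNP.Theorems.ChebyshevTracialDesignCrossingPlaneRemainder

/-! ### §1 The seven remainders against a constant smoothness bound -/

/-- **Brick 120's seven remainders with constant smoothness numbers.** With `r₁, r₂, r₃ ≤ 1` (the powers `ρ^{D+1}, ρ^D,
ρ^{D−1}`), `h = |H|/n ≤ 1`, `h₂ = |H|²/(n(n−2)) ≤ 1`, `cD = C(2D,D)/4^D ≤ 1`, `T ≤ t` and `2D + 2 ≤ t`, the remainder
expression of bricks 120/123/124 evaluated at `X_{D−1} = X_D = X_{D+1} = Ξ` is at most `200·t²·G·((2D+1) + B_v C_b)·Ξ`.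
[cite: Rothvoss2017, §2 (PDF p. 6)] [cite: Agarwal2000DifferenceEquations, Remark 1.8.1 (1.8.8)] -/
theorem remainder_le {Bv Cb tt G r₁ r₂ r₃ Ξ cD DD TT h h₂ : ℝ} (hBv : 0 ≤ Bv) (hCb : 0 ≤ Cb) (hG : 0 ≤ G)
    (hr₁ : 0 ≤ r₁) (hr₂ : 0 ≤ r₂) (hr₃ : 0 ≤ r₃) (hΞ : 0 ≤ Ξ) (hDD : 0 ≤ DD) (hTT : 0 ≤ TT)
    (hh : 0 ≤ h) (hh₂ : 0 ≤ h₂) (hr₁1 : r₁ ≤ 1) (hr₂1 : r₂ ≤ 1) (hr₃1 : r₃ ≤ 1) (hcD1 : cD ≤ 1) (hh1 : h ≤ 1)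
    (hh₂1 : h₂ ≤ 1) (hTt : TT ≤ tt) (hDt : 2 * DD + 2 ≤ tt) :
    (Bv * Cb *
          ((9 * tt ^ 2 * G) * (r₁ * Ξ)) +
      2 * ((2 * DD + 1) * cD *
            ((3 * tt * G) * (r₂ * Ξ)) +
          Bv * Cb *
            (TT * ((3 * tt * G) * (r₁ * Ξ)) +
              2 * (DD + 1) * ((3 * tt * G) * (r₂ * Ξ)))) +
      ((2 * DD + 1) * cD *
          (TT * (G * (r₂ * Ξ)) +
            2 * DD * (G * (r₃ * Ξ))) +
        Bv * Cb *
          (TT * (TT * (G * (r₁ * Ξ)) +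
              2 * (DD + 1) * (G * (r₂ * Ξ))) +
            2 * (DD + 1) * (TT * (G * (r₂ * Ξ)) +
              2 * DD * (G * (r₃ * Ξ))))) +
      4 * ((2 * DD + 1) * cD *
            (h * ((3 * tt * G) * (r₂ * Ξ))) +
          Bv * Cb *
            (TT * (h * ((3 * tt * G) *
                (r₁ * Ξ))) +
              2 * (DD + 1) * (h * ((3 * tt * G) *
                (r₂ * Ξ))))) +
      4 * ((2 * DD + 1) * cD *
            (TT * (h * (G * (r₂ * Ξ))) +
              2 * DD * (h * (G * (r₃ * Ξ)))) +
          Bv * Cb *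
            (TT * (TT * (h * (G * (r₁ * Ξ))) +
                2 * (DD + 1) * (h * (G * (r₂ * Ξ)))) +
              2 * (DD + 1) * (TT * (h * (G * (r₂ * Ξ))) +
                2 * DD * (h * (G * (r₃ * Ξ)))))) +
      4 * ((2 * DD + 1) * cD *
            (h * (G * (r₂ * Ξ))) +
          Bv * Cb *
            (TT * (h * (G * (r₁ * Ξ))) +
              2 * (DD + 1) * (h * (G * (r₂ * Ξ))))) +
      4 * ((2 * DD + 1) * cD *
            (h₂ * (G * (TT * (r₂ * Ξ) +
              2 * DD * (r₃ * Ξ)))) +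
          Bv * Cb *
            (TT * (h₂ *
                (G * (TT * (r₁ * Ξ) +
                  2 * (DD + 1) * (r₂ * Ξ)))) +
              2 * (DD + 1) * (h₂ *
                (G * (TT * (r₂ * Ξ) +
                  2 * DD * (r₃ * Ξ))))))) ≤
      200 * tt ^ 2 * G * ((2 * DD + 1) + Bv * Cb) * Ξ := by
  have htt : 1 ≤ tt := by linarith
  have htt0 : 0 ≤ tt := by linarith
  calc (Bv * Cb *
          ((9 * tt ^ 2 * G) * (r₁ * Ξ)) +
      2 * ((2 * DD + 1) * cD *
            ((3 * tt * G) * (r₂ * Ξ)) +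
          Bv * Cb *
            (TT * ((3 * tt * G) * (r₁ * Ξ)) +
              2 * (DD + 1) * ((3 * tt * G) * (r₂ * Ξ)))) +
      ((2 * DD + 1) * cD *
          (TT * (G * (r₂ * Ξ)) +
            2 * DD * (G * (r₃ * Ξ))) +
        Bv * Cb *
          (TT * (TT * (G * (r₁ * Ξ)) +
              2 * (DD + 1) * (G * (r₂ * Ξ))) +
            2 * (DD + 1) * (TT * (G * (r₂ * Ξ)) +
              2 * DD * (G * (r₃ * Ξ))))) +
      4 * ((2 * DD + 1) * cD *
            (h * ((3 * tt * G) * (r₂ * Ξ))) +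
          Bv * Cb *
            (TT * (h * ((3 * tt * G) *
                (r₁ * Ξ))) +
              2 * (DD + 1) * (h * ((3 * tt * G) *
                (r₂ * Ξ))))) +
      4 * ((2 * DD + 1) * cD *
            (TT * (h * (G * (r₂ * Ξ))) +
              2 * DD * (h * (G * (r₃ * Ξ)))) +
          Bv * Cb *
            (TT * (TT * (h * (G * (r₁ * Ξ))) +
                2 * (DD + 1) * (h * (G * (r₂ * Ξ)))) +
              2 * (DD + 1) * (TT * (h * (G * (r₂ * Ξ))) +
                2 * DD * (h * (G * (r₃ * Ξ)))))) +
      4 * ((2 * DD + 1) * cD *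
            (h * (G * (r₂ * Ξ))) +
          Bv * Cb *
            (TT * (h * (G * (r₁ * Ξ))) +
              2 * (DD + 1) * (h * (G * (r₂ * Ξ))))) +
      4 * ((2 * DD + 1) * cD *
            (h₂ * (G * (TT * (r₂ * Ξ) +
              2 * DD * (r₃ * Ξ)))) +
          Bv * Cb *
            (TT * (h₂ *
                (G * (TT * (r₁ * Ξ) +
                  2 * (DD + 1) * (r₂ * Ξ)))) +
              2 * (DD + 1) * (h₂ *
                (G * (TT * (r₂ * Ξ) +
                  2 * DD * (r₃ * Ξ)))))))
      ≤ (Bv * Cb *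
          ((9 * tt ^ 2 * G) * (1 * Ξ)) +
      2 * ((2 * DD + 1) * 1 *
            ((3 * tt * G) * (1 * Ξ)) +
          Bv * Cb *
            (tt * ((3 * tt * G) * (1 * Ξ)) +
              2 * (DD + 1) * ((3 * tt * G) * (1 * Ξ)))) +
      ((2 * DD + 1) * 1 *
          (tt * (G * (1 * Ξ)) +
            2 * DD * (G * (1 * Ξ))) +
        Bv * Cb *
          (tt * (tt * (G * (1 * Ξ)) +
              2 * (DD + 1) * (G * (1 * Ξ))) +
            2 * (DD + 1) * (tt * (G * (1 * Ξ)) +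
              2 * DD * (G * (1 * Ξ))))) +
      4 * ((2 * DD + 1) * 1 *
            (1 * ((3 * tt * G) * (1 * Ξ))) +
          Bv * Cb *
            (tt * (1 * ((3 * tt * G) *
                (1 * Ξ))) +
              2 * (DD + 1) * (1 * ((3 * tt * G) *
                (1 * Ξ))))) +
      4 * ((2 * DD + 1) * 1 *
            (tt * (1 * (G * (1 * Ξ))) +
              2 * DD * (1 * (G * (1 * Ξ)))) +
          Bv * Cb *
            (tt * (tt * (1 * (G * (1 * Ξ))) +
                2 * (DD + 1) * (1 * (G * (1 * Ξ)))) +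
              2 * (DD + 1) * (tt * (1 * (G * (1 * Ξ))) +
                2 * DD * (1 * (G * (1 * Ξ)))))) +
      4 * ((2 * DD + 1) * 1 *
            (1 * (G * (1 * Ξ))) +
          Bv * Cb *
            (tt * (1 * (G * (1 * Ξ))) +
              2 * (DD + 1) * (1 * (G * (1 * Ξ))))) +
      4 * ((2 * DD + 1) * 1 *
            (1 * (G * (tt * (1 * Ξ) +
              2 * DD * (1 * Ξ)))) +
          Bv * Cb *
            (tt * (1 *
                (G * (tt * (1 * Ξ) +
                  2 * (DD + 1) * (1 * Ξ)))) +
              2 * (DD + 1) * (1 *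
                (G * (tt * (1 * Ξ) +
                  2 * DD * (1 * Ξ))))))) := by
        gcongr
    _ = Ξ * G * ((2 * DD + 1) * (4 + 18 * DD + 27 * tt) +
          Bv * Cb * (8 + 44 * DD + 36 * DD ^ 2 + 76 * tt + 36 * tt ^ 2 + 72 * DD * tt)) := by ring
    _ ≤ 200 * tt ^ 2 * G * ((2 * DD + 1) + Bv * Cb) * Ξ := by
        have hp1 : 4 + 18 * DD + 27 * tt ≤ 40 * tt ^ 2 := by nlinarith
        have hp2 : 8 + 44 * DD + 36 * DD ^ 2 + 76 * tt + 36 * tt ^ 2 + 72 * DD * tt ≤ 187 * tt ^ 2 := by nlinarith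
        have h1 := mul_le_mul_of_nonneg_left hp1 (show 0 ≤ 2 * DD + 1 by positivity)
        have h2 := mul_le_mul_of_nonneg_left hp2 (mul_nonneg hBv hCb)
        have h3 : (2 * DD + 1) * (4 + 18 * DD + 27 * tt) +
            Bv * Cb * (8 + 44 * DD + 36 * DD ^ 2 + 76 * tt + 36 * tt ^ 2 + 72 * DD * tt) ≤
            200 * tt ^ 2 * ((2 * DD + 1) + Bv * Cb) := by
          nlinarith [mul_nonneg (mul_nonneg hBv hCb) (sq_nonneg tt),
            mul_nonneg (show 0 ≤ 2 * DD + 1 by positivity) (sq_nonneg tt)]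
        have h4 := mul_le_mul_of_nonneg_left h3 (mul_nonneg hΞ hG)
        nlinarith [h4]


end Summit.PneNP.PneNP.Theorems.ChebyshevTracialDesignCrossingPlaneRemainder

end
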